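import Literature.AlgebraicGeometry.Frobenioids.RealificationDataCanonical
import Literature.AlgebraicGeometry.Frobenioids.RealificationModelRow
import Literature.AlgebraicGeometry.Frobenioids.RealPowNNRealLinear
import Literature.AlgebraicGeometry.Frobenioids.RlfStructure
import Literature.AnabelianGeometry.EtaleTheta.RealificationCoordinates
import HarnessLib

/-!
# Prime coordinates on `(M^rlf)^gp` and finite presentations of `ℝ · Ψ` (toolkit for [EtTh] Def 3.6 (i), `Λ = ℝ`)

Source of the objects: S. Mochizuki, *The geometry of Frobenioids I*, Kyushu J. Math. **62** (2008) [FrdI], §2,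
Def. 2.4 (i) p.48 (`M^rlf ⊆ M^rlf_factor = ∏_𝔭 M^rlf_𝔭`, "`(M^rlf)^gp ⊆ ∏ (M^rlf_𝔭)^gp` is an `ℝ`-vector space") and
§5, Prop. 5.3 p.103 (`ℝ · Φ^birat ⊆ (Φ^rlf)^gp`, "the `ℝ`-vector subspace generated by `Φ^birat`")
[cite: MochizukiFrdI2008, Def. 2.4(i) p.48]; used by S. Mochizuki, *The étale theta function …* [EtTh], Def. 3.6 (i)
p.302 (`B₀^ℝ := ℝ·Φ₀^birat`, `F₀^ℝ := ℝ·Φ₀^cnst`).  Written for the abc-iut cell, sub-DAG `plan/L2/SUBDAG-EtTh-Thm37.md`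
row «EtTh:Thm3.7(iii)/L10-R-fin» (the finitely-many-`ℚ`-primes case of the effective-locus clause of
`RealifiedDivisorMonoids.Prop34Cnst (ofRlfR …)`, `Discharge/Sec3Prop34CnstOfRlfRFinite.lean`); elementary and reusable:

* `PrimeCoord.coord h 𝔮 f : M^rlf → ℝ_{≥0}` — the `𝔮`-component `M^rlf → M^rlf_𝔮` followed by a COORDINATE
  `f : M^rlf_𝔮 ≅ ℝ_{≥0}` (such `f` exist for monoprime `M^pf_𝔮`, `RealificationCoord.nonempty_coord`), and its real
  groupification `PrimeCoord.coordGp h 𝔮 f : (M^rlf)^gp → (ℝ, +)`;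
* `toAdd_coordGp_realSMul` — `coordGp` is `ℝ`-LINEAR for the vector-space structure `realSMul` of Def. 2.4 (i);
* `exists_eq_of_of_coordGp_nonneg` — an element of `(M^rlf)^gp` all of whose prime coordinates are `≥ 0` is the
  class of an element of `M^rlf` (divisibility in `M^rlf` is coordinatewise, `IsPerfFactorial.Rlf.dvd_iff`);
* `exists_nnrat_coord_toRealification` — on the image of `M^pf` the coordinate at a `ℚ`-monoprime `M^pf_𝔮` takes
  values in `c_𝔮 · ℚ_{≥0}` for one constant `c_𝔮 > 0` (`RealificationCoord.chart_Q`);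
* `RealificationData.exists_prod_of_mem_realSpan` — every element of `(ℝ · Ψ)(X)` (for ANY realification datum) is
  a finite product `∏_k r_k • ι(c_k)`, `c_k ∈ Ψ(X)`.
Proof-only in content (the three `def`s are abbreviations of composites of existing homomorphisms); nothing here
bears on [IUTchIII] Cor. 3.12.
-/

noncomputable section

namespace Literature.AnabelianGeometry.EtaleTheta

open Function NNReal Literature.AlgebraicGeometry.Frobenioids

universe u

namespace PrimeCoord

variable {M : Type u} [CommMonoid M] (h : IsPerfFactorial M)

/-- The `𝔮`-component `M^rlf → M^rlf_𝔮` (restriction of the projection of `M^rlf_factor = ∏_𝔮 M^rlf_𝔮`).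
[cite: MochizukiFrdI2008, Def. 2.4(i) p.48] -/
def evalAt (𝔮 : Primes (Perfection M)) : h.Rlf →* RlfAt M 𝔮 :=
  (Pi.evalMonoidHom (fun 𝔮 : Primes (Perfection M) => RlfAt M 𝔮) 𝔮).comp h.realification.subtype

/-- `evalAt` is the `𝔮`-component. [cite: MochizukiFrdI2008, Def. 2.4(i) p.48] -/
@[simp] theorem evalAt_apply (𝔮 : Primes (Perfection M)) (a : h.Rlf) : evalAt h 𝔮 a = (a : RlfFactor M) 𝔮 := rfl

/-- **The prime coordinate** `M^rlf → M^rlf_𝔮 ≅ ℝ_{≥0}` attached to a coordinate `f` of the `ℝ`-monoprime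
completion `M^rlf_𝔮 = M^pf_𝔮 ⊗ ℝ_{≥0}`. [cite: MochizukiFrdI2008, Def. 2.4(i) p.48] -/
def coord (𝔮 : Primes (Perfection M)) (f : RlfAt M 𝔮 ≃* Multiplicative ℝ≥0) : h.Rlf →* Multiplicative ℝ≥0 :=
  f.toMonoidHom.comp (evalAt h 𝔮)

/-- `coord` unfolded. [cite: MochizukiFrdI2008, Def. 2.4(i) p.48] -/
theorem coord_apply (𝔮 : Primes (Perfection M)) (f : RlfAt M 𝔮 ≃* Multiplicative ℝ≥0) (a : h.Rlf) :
    coord h 𝔮 f a = f ((a : RlfFactor M) 𝔮) := rfl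

/-- `ℝ_{≥0} ↪ (ℝ, +)`, multiplicatively. [folklore] -/
def toRealMul : Multiplicative ℝ≥0 →* Multiplicative ℝ :=
  AddMonoidHom.toMultiplicative NNReal.toRealHom.toAddMonoidHom

/-- `toRealMul` is the coercion. [folklore] -/
@[simp] private theorem toAdd_toRealMul (x : Multiplicative ℝ≥0) :
    Multiplicative.toAdd (toRealMul x) = ((Multiplicative.toAdd x : ℝ≥0) : ℝ) := rfl

/-- **The real prime coordinate on `(M^rlf)^gp`**: the groupification `(M^rlf)^gp → (ℝ, +)` of
`M^rlf → ℝ_{≥0} ⊆ ℝ` (a coordinate of the factor `(M^rlf_𝔭)^gp` of the `ℝ`-vector space of Def. 2.4 (i)).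
[cite: MochizukiFrdI2008, Def. 2.4(i) p.48] -/
def coordGp (𝔮 : Primes (Perfection M)) (f : RlfAt M 𝔮 ≃* Multiplicative ℝ≥0) :
    Algebra.GrothendieckGroup h.Rlf →* Multiplicative ℝ :=
  Algebra.GrothendieckGroup.lift (toRealMul.comp (coord h 𝔮 f))

variable {h}

/-- `coordGp [a] = coord a`. [cite: MochizukiFrdI2008, Def. 2.4(i) p.48] -/
theorem coordGp_of (𝔮 : Primes (Perfection M)) (f : RlfAt M 𝔮 ≃* Multiplicative ℝ≥0) (a : h.Rlf) :
    coordGp h 𝔮 f (Algebra.GrothendieckGroup.of a) = toRealMul (coord h 𝔮 f a) := by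
  have h' := Algebra.GrothendieckGroup.lift.symm_apply_apply (toRealMul.comp (coord h 𝔮 f))
  rw [Algebra.GrothendieckGroup.lift_symm_apply] at h'
  exact DFunLike.congr_fun h' a

/-- `coordGp [a]` as a real number is the (nonnegative) coordinate of `a`. [cite: MochizukiFrdI2008, Def. 2.4(i) p.48] -/
theorem toAdd_coordGp_of (𝔮 : Primes (Perfection M)) (f : RlfAt M 𝔮 ≃* Multiplicative ℝ≥0) (a : h.Rlf) :
    Multiplicative.toAdd (coordGp h 𝔮 f (Algebra.GrothendieckGroup.of a)) =
      ((Multiplicative.toAdd (coord h 𝔮 f a) : ℝ≥0) : ℝ) := by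
  rw [coordGp_of, toAdd_toRealMul]

/-- The coordinate of a class `[a]`, `a ∈ M^rlf`, is `≥ 0`. [cite: MochizukiFrdI2008, Def. 2.4(i) p.48] -/
theorem coordGp_of_nonneg (𝔮 : Primes (Perfection M)) (f : RlfAt M 𝔮 ≃* Multiplicative ℝ≥0) (a : h.Rlf) :
    0 ≤ Multiplicative.toAdd (coordGp h 𝔮 f (Algebra.GrothendieckGroup.of a)) := by
  rw [toAdd_coordGp_of]
  exact NNReal.coe_nonneg _

/-- The coordinate of a real power: `coord (a^r) = r · coord a` (every homomorphism `M^rlf → ℝ_{≥0}` is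
`ℝ_{≥0}`-linear, `IsPerfFactorial.Rlf.hom_nnreal_rpow`). [cite: MochizukiFrdI2008, Def. 2.4(ii) p.48] -/
theorem toAdd_coordGp_of_rpow (𝔮 : Primes (Perfection M)) (f : RlfAt M 𝔮 ≃* Multiplicative ℝ≥0) (r : ℝ≥0)
    (a : h.Rlf) :
    Multiplicative.toAdd (coordGp h 𝔮 f (Algebra.GrothendieckGroup.of (IsPerfFactorial.Rlf.rpow h r a))) =
      r * Multiplicative.toAdd (coordGp h 𝔮 f (Algebra.GrothendieckGroup.of a)) := by
  rw [toAdd_coordGp_of, toAdd_coordGp_of, IsPerfFactorial.Rlf.hom_nnreal_rpow h (coord h 𝔮 f) r a, NNReal.coe_mul]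

/-- **`coordGp` is `ℝ`-linear**: `coordGp (r • ξ) = r · coordGp ξ` for the `ℝ`-vector-space structure `realSMul` of
`(M^rlf)^gp` (Def. 2.4 (i)). [cite: MochizukiFrdI2008, Def. 2.4(i) p.48] -/
theorem toAdd_coordGp_realSMul (𝔮 : Primes (Perfection M)) (f : RlfAt M 𝔮 ≃* Multiplicative ℝ≥0) (r : ℝ)
    (ξ : Algebra.GrothendieckGroup h.Rlf) :
    Multiplicative.toAdd (coordGp h 𝔮 f (IsPerfFactorial.Rlf.realSMul h r ξ)) =
      r * Multiplicative.toAdd (coordGp h 𝔮 f ξ) := by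
  obtain ⟨a, b, rfl⟩ := IsPerfFactorial.Rlf.gp_exists_eq_div h ξ
  rw [map_div, IsPerfFactorial.Rlf.realSMul_of, IsPerfFactorial.Rlf.realSMul_of]
  simp only [map_div, toAdd_div, toAdd_coordGp_of_rpow]
  have hr : ((r.toNNReal : ℝ≥0) : ℝ) - (((-r).toNNReal : ℝ≥0) : ℝ) = r := by
    rcases le_total 0 r with h0 | h0
    · rw [Real.coe_toNNReal r h0, Real.toNNReal_of_nonpos (neg_nonpos.mpr h0), NNReal.coe_zero, sub_zero]
    · rw [Real.toNNReal_of_nonpos h0, Real.coe_toNNReal (-r) (neg_nonneg.mpr h0), NNReal.coe_zero, zero_sub, neg_neg]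
  linear_combination (Multiplicative.toAdd (coordGp h 𝔮 f (Algebra.GrothendieckGroup.of a)) -
    Multiplicative.toAdd (coordGp h 𝔮 f (Algebra.GrothendieckGroup.of b))) * hr

/-! ### Divisibility in `M^rlf` and effectivity in `(M^rlf)^gp` are read off the prime coordinates -/

/-- If every prime coordinate of `p'` is `≤` that of `p` (for some family of coordinates `f_𝔮`), then `p' ∣ p` in
`M^rlf` ("`≤` in `M^rlf` iff in `M^rlf_factor`", Def. 2.4 (i) p.48; the order of each `ℝ`-monoprime `M^rlf_𝔮` is that of
`ℝ_{≥0}`). [cite: MochizukiFrdI2008, Def. 2.4(i) p.48] -/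
theorem dvd_of_coord_le (f : ∀ 𝔮 : Primes (Perfection M), RlfAt M 𝔮 ≃* Multiplicative ℝ≥0) {p p' : h.Rlf}
    (hle : ∀ 𝔮, coord h 𝔮 (f 𝔮) p' ≤ coord h 𝔮 (f 𝔮) p) : p' ∣ p := by
  rw [IsPerfFactorial.Rlf.dvd_iff]
  intro 𝔮
  have h1 : f 𝔮 ((p' : RlfFactor M) 𝔮) ∣ f 𝔮 ((p : RlfFactor M) 𝔮) :=
    (RealificationCoord.mnnreal_dvd_iff_le _ _).mpr (hle 𝔮)
  exact (map_dvd_iff (f 𝔮)).mp h1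

/-- **Effectivity from coordinates**: an element of `(M^rlf)^gp` all of whose real prime coordinates are `≥ 0` is
the class of an element of `M^rlf`. [cite: MochizukiFrdI2008, Def. 2.4(i) p.48] -/
theorem exists_eq_of_of_coordGp_nonneg (f : ∀ 𝔮 : Primes (Perfection M), RlfAt M 𝔮 ≃* Multiplicative ℝ≥0)
    (ξ : Algebra.GrothendieckGroup h.Rlf) (h0 : ∀ 𝔮, 0 ≤ Multiplicative.toAdd (coordGp h 𝔮 (f 𝔮) ξ)) :
    ∃ y : h.Rlf, ξ = Algebra.GrothendieckGroup.of y := by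
  obtain ⟨p, p', rfl⟩ := IsPerfFactorial.Rlf.gp_exists_eq_div h ξ
  have hle : ∀ 𝔮, coord h 𝔮 (f 𝔮) p' ≤ coord h 𝔮 (f 𝔮) p := by
    intro 𝔮
    have h1 := h0 𝔮
    rw [map_div, toAdd_div, toAdd_coordGp_of, toAdd_coordGp_of, sub_nonneg, NNReal.coe_le_coe] at h1
    exact h1
  obtain ⟨y, hy⟩ := dvd_of_coord_le f hle
  exact ⟨y, by rw [hy, map_mul, mul_div_cancel_left]⟩

/-! ### Rationality of the coordinates on `M^pf` at a `ℚ`-monoprime `M^pf_𝔮` -/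

/-- **On `M^pf` the coordinate at a `ℚ`-monoprime `M^pf_𝔮` is `c_𝔮`-times a nonnegative RATIONAL** for one
constant `c_𝔮 ≠ 0` (the factorization homomorphism has image in `M^pf_factor = ∏ M^pf_𝔮`, Def. 2.4 (i)(c), and a
coordinate of `M^pf_𝔮 ⊗ ℝ_{≥0}` restricted to `M^pf_𝔮 ≅ ℚ_{≥0}` is a homothety, `RealificationCoord.chart_Q`).
[cite: MochizukiFrdI2008, Def. 2.4(i) p.47] -/
theorem exists_nnrat_coord_toRealification (𝔮 : Primes (Perfection M)) (hQ : IsQMonoprime (PfAt M 𝔮))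
    (f : RlfAt M 𝔮 ≃* Multiplicative ℝ≥0) :
    ∃ c : ℝ≥0, c ≠ 0 ∧ ∀ a : Perfection M, ∃ q : ℚ≥0,
      Multiplicative.toAdd (coord h 𝔮 f (h.toRealification a)) = c * (q : ℝ≥0) := by
  obtain ⟨e⟩ := hQ.nonempty_mulEquiv
  obtain ⟨c, hc, hchart⟩ := RealificationCoord.chart_Q f e
  refine ⟨c, hc, fun a => ?_⟩
  obtain ⟨x, hx⟩ := h.factorMap_mem_range a
  refine ⟨Multiplicative.toAdd (e (x 𝔮)), ?_⟩
  rw [coord_apply, ← hchart (x 𝔮)]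
  congr 2
  change factorMap M a 𝔮 = _
  rw [← hx, pfFactorToRlfFactor_apply]

end PrimeCoord

/-! ### Finite presentations of the elements of `ℝ · Ψ` -/

namespace RealificationDataLemmas

open CategoryTheory Opposite

variable {D : Type u} [Category D] {Φ : Dᵒᵖ ⥤ CommMonCat.{u}} (R : RealificationData Φ) (Ψ : GpSubfunctor Φ)

/-- `(-r) • x = (r • x)⁻¹` in `(Φ^rlf)^gp(X)` (from `rsmul_add`, `rsmul_zero`). [cite: MochizukiFrdI2008, Def. 2.4(i) p.48] -/
theorem rsmul_neg (X : D) (r : ℝ) (x : Algebra.GrothendieckGroup (R.rlf.obj (op X))) :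
    R.rsmul X (-r) x = (R.rsmul X r x)⁻¹ := by
  have h := R.rsmul_add X r (-r) x
  rw [add_neg_cancel, R.rsmul_zero] at h
  exact eq_inv_of_mul_eq_one_right h.symm

/-- **Every element of `(ℝ · Ψ)(X)` is a finite product `∏_k r_k • ι(c_k)` with `c_k ∈ Ψ(X)`** (the subgroup
generated by the `r • ι(c)` consists of such products: inverses flip the sign of `r`).
[cite: MochizukiFrdI2008, Prop. 5.3 p.103] -/
theorem exists_prod_of_mem_realSpan (X : D) {x : Algebra.GrothendieckGroup (R.rlf.obj (op X))}
    (hx : x ∈ (R.realSpan Ψ).carrier X) :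
    ∃ (n : ℕ) (r : Fin n → ℝ) (c : Fin n → Algebra.GrothendieckGroup (Φ.obj (op X))),
      (∀ k, c k ∈ Ψ.carrier X) ∧ x = ∏ k, R.rsmul X (r k) (R.toRlfGp X (c k)) := by
  induction hx using Subgroup.closure_induction with
  | mem y hy =>
    obtain ⟨r, c, hc, rfl⟩ := hy
    exact ⟨1, fun _ => r, fun _ => c, fun _ => hc, by rw [Fin.prod_univ_one]⟩
  | one => exact ⟨0, Fin.elim0, Fin.elim0, fun k => k.elim0, by rw [Fin.prod_univ_zero]⟩
  | mul y z _ _ hy hz =>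
    obtain ⟨n, r, c, hc, rfl⟩ := hy
    obtain ⟨m, s, d, hd, rfl⟩ := hz
    refine ⟨n + m, Fin.append r s, Fin.append c d, fun k => ?_, ?_⟩
    · refine Fin.addCases (fun i => ?_) (fun j => ?_) k
      · rw [Fin.append_left]; exact hc i
      · rw [Fin.append_right]; exact hd j
    · rw [Fin.prod_univ_add]
      simp only [Fin.append_left, Fin.append_right]
  | inv y _ hy =>
    obtain ⟨n, r, c, hc, rfl⟩ := hy
    refine ⟨n, fun k => -r k, c, hc, ?_⟩
    rw [← Finset.prod_inv_distrib]
    exact Finset.prod_congr rfl fun k _ => (rsmul_neg R X (r k) _).symm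

end RealificationDataLemmas

/-! ### v2 (append-only): the finite presentation with independent universes for the base category and the monoids -/

namespace RealificationDataLemmas

open CategoryTheory Opposite

universe u' v' w'

variable {D : Type u'} [Category.{v'} D] {Φ : Dᵒᵖ ⥤ CommMonCat.{w'}} (R : RealificationData Φ) (Ψ : GpSubfunctor Φ)

/-- `(-r) • x = (r • x)⁻¹` in `(Φ^rlf)^gp(X)` — universe-general form of `rsmul_neg`.
[cite: MochizukiFrdI2008, Def. 2.4(i) p.48] -/
theorem rsmul_neg' (X : D) (r : ℝ) (x : Algebra.GrothendieckGroup (R.rlf.obj (op X))) :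
    R.rsmul X (-r) x = (R.rsmul X r x)⁻¹ := by
  have h := R.rsmul_add X r (-r) x
  rw [add_neg_cancel, R.rsmul_zero] at h
  exact eq_inv_of_mul_eq_one_right h.symm

/-- **Every element of `(ℝ · Ψ)(X)` is a finite product `∏_k r_k • ι(c_k)` with `c_k ∈ Ψ(X)`** — universe-general
form of `exists_prod_of_mem_realSpan` (base category, morphisms and monoids in independent universes, as in
`RealificationData`). [cite: MochizukiFrdI2008, Prop. 5.3 p.103] -/
theorem exists_prod_rsmul_of_mem_realSpan (X : D) {x : Algebra.GrothendieckGroup (R.rlf.obj (op X))}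
    (hx : x ∈ (R.realSpan Ψ).carrier X) :
    ∃ (n : ℕ) (r : Fin n → ℝ) (c : Fin n → Algebra.GrothendieckGroup (Φ.obj (op X))),
      (∀ k, c k ∈ Ψ.carrier X) ∧ x = ∏ k, R.rsmul X (r k) (R.toRlfGp X (c k)) := by
  induction hx using Subgroup.closure_induction with
  | mem y hy =>
    obtain ⟨r, c, hc, rfl⟩ := hy
    exact ⟨1, fun _ => r, fun _ => c, fun _ => hc, by rw [Fin.prod_univ_one]⟩
  | one => exact ⟨0, Fin.elim0, Fin.elim0, fun k => k.elim0, by rw [Fin.prod_univ_zero]⟩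
  | mul y z _ _ hy hz =>
    obtain ⟨n, r, c, hc, rfl⟩ := hy
    obtain ⟨m, s, d, hd, rfl⟩ := hz
    refine ⟨n + m, Fin.append r s, Fin.append c d, fun k => ?_, ?_⟩
    · refine Fin.addCases (fun i => ?_) (fun j => ?_) k
      · rw [Fin.append_left]; exact hc i
      · rw [Fin.append_right]; exact hd j
    · rw [Fin.prod_univ_add]
      simp only [Fin.append_left, Fin.append_right]
  | inv y _ hy =>
    obtain ⟨n, r, c, hc, rfl⟩ := hy
    refine ⟨n, fun k => -r k, c, hc, ?_⟩
    rw [← Finset.prod_inv_distrib]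
    exact Finset.prod_congr rfl fun k _ => (rsmul_neg' R X (r k) _).symm

end RealificationDataLemmas

end Literature.AnabelianGeometry.EtaleTheta

end
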